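import Literature.Probability.RandomPlanarGeometry.HexParafermion
import Literature.Probability.RandomPlanarGeometry.HexSAW

/-!
# Crux `ObservableToSLER` (stmt-CriticalPhenomena-14005): the typed a-priori input `RootRenewal` of crux idea `root-renewal-kesten` — its two defects, checked

Negative lemmas (refuter, cdisprove cycle 2).  The crux idea card `root-renewal-kesten`
(`Cruxes/ObservableToSLER/Ideas/root-renewal-kesten.md`, sketch `RootRenewalSketch.lean`) types
its load-bearing input as `RootRenewal` (RR): for the critical hexagonal SAW from a source at depth
`d` above an exact floor of radius `R₀`, to ANY far target in ANY simply connected domain agreeing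
with the half-lattice inside the `R₀`-ball, the mass of walks with no "renewal row" among the rows
`(m + d, m + 2^K d]` is at most `ε` of the total.  A renewal row is typed as
`IsRenewalRow γ h := ∃ k, (∀ v ∈ verts.take k, row v < h) ∧ (∀ v ∈ verts.drop k, h ≤ row v)`.
Two triagers (TRIAGE-r1-2, r1-3) refuted RR on paper; here the combinatorial core is checked:

* the typed renewal admits the VACUOUS splits `k = length` / `k = 0`
  (`isRenewalRowList_of_forall_lt`, `isRenewalRowList_of_forall_ge`);
* DEFECT (a), LOW TARGET: if the last vertex lies below row `h`, the typed renewal at `h` holds iff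
  the whole walk lies below row `h` (`isRenewalRowList_iff_of_getLast_lt`); consequently, for a
  target mid-edge below the window, "no renewal in `(h₁, h₂]`" is EXACTLY "the walk reaches row
  `h₂`" (`noRenewal_iff_reaches_top`) — RR then asserts that reaching height `2^K d` before a far
  floor-level target has conditional mass `≤ ε` UNIFORMLY in the far geometry, which strip
  confinement defeats;
* DEFECT (b), U-PROFILE: a vertex at or above row `h` followed later by a vertex below row `h`
  excludes the typed renewal at `h` (`not_isRenewalRowList_of_high_then_low`); so on any domain
  forcing every walk through a high arch and back down to a low target, `noRenewalObs` is the full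
  observable (`noRenewalObs_eq_of_forcedU`) and RR's inequality fails for every `ε < 1` once one
  walk exists (`rr_ineq_false_of_forcedU`, `Z_pos_of_nonempty`).

The definitions `row`, `IsRenewalRow`, `noRenewalObs`, `Z` are verbatim copies of the sketch's
(which lives in a crux workfile and is not importable); `IsRenewalRowList` is the same predicate on
a bare vertex list.  For reference, the sketch's RR reads
`∀ ε > 0, ∃ K, ∀ d ≥ 1, ∃ R₀ > 0, ∀ Λ m u w z, hexDomainSimplyConnected Λ → hexGraph.Adj u w → w ∈ Λ →
row w = m + d → (∀ v, dist (hexCenter v) (hexCenter w) ≤ R₀ → (v ∈ Λ ↔ m ≤ row v)) →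
z ∈ hexDomainMidEdges Λ → (∀ v ∈ z, R₀ ≤ dist (hexCenter v) (hexCenter w)) →
(noRenewalObs Λ s(u, w) z x_c 0 (m + d) (m + 2 ^ K * d)).re ≤ ε * Z Λ s(u, w) z`;
`rootRenewal_conclusion_false` negates its last line on every forcing instance.  The lattice realisation of the forcing domain of (b) for arbitrary
`R₀, K` (half-ball patch + width-one U-corridor outside the ball) is recorded, unformalised, in
`Cruxes/ObservableToSLER/Disproof.lean` §12.
-/

noncomputable section

open Literature.Probability.RandomPlanarGeometry Literature.Probability.RandomPlanarGeometry.SAW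
  Literature.Probability.LatticeModels
open scoped Classical

namespace Summit.CriticalPhenomena.SAWScalingLimit.Theorems.ObservableToSLER.Negative

namespace RootRenewalDefects

/-- Row (second cell coordinate) of a honeycomb vertex (copy of the sketch's `row`). [folklore] -/
def row (v : HexVertex) : ℤ := v.1 1

/-- Copy of the sketch's `IsRenewalRow`: a prefix strictly below row `h` followed by a suffix at or
above it — NOT "exactly one edge joins rows `h − 1` and `h`" (the vacuous splits below); an auxiliary
predicate, not a fact. [folklore] -/
def IsRenewalRow {Λ : Finset HexVertex} {a z : Sym2 HexVertex} (γ : HexMidEdgeSAW Λ a z) (h : ℤ) :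
    Prop :=
  ∃ k : ℕ, (∀ v ∈ γ.verts.take k, row v < h) ∧ (∀ v ∈ γ.verts.drop k, h ≤ row v)

/-- The same predicate on a bare vertex list; an auxiliary predicate, not a fact. [folklore] -/
def IsRenewalRowList (l : List HexVertex) (h : ℤ) : Prop :=
  ∃ k : ℕ, (∀ v ∈ l.take k, row v < h) ∧ (∀ v ∈ l.drop k, h ≤ row v)

/-- `IsRenewalRow γ h` is `IsRenewalRowList γ.verts h`. [folklore] -/
theorem isRenewalRow_iff_list {Λ : Finset HexVertex} {a z : Sym2 HexVertex}
    (γ : HexMidEdgeSAW Λ a z) (h : ℤ) : IsRenewalRow γ h ↔ IsRenewalRowList γ.verts h := Iff.rfl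

/-- VACUOUS SPLIT 1: a list entirely below row `h` "has renewal row `h`" (`k = length`). [folklore] -/
theorem isRenewalRowList_of_forall_lt {l : List HexVertex} {h : ℤ} (hl : ∀ v ∈ l, row v < h) :
    IsRenewalRowList l h :=
  ⟨l.length, fun v hv => hl v (List.mem_of_mem_take hv), by simp⟩

/-- VACUOUS SPLIT 2: a list entirely at or above row `h` "has renewal row `h`" (`k = 0`). [folklore] -/
theorem isRenewalRowList_of_forall_ge {l : List HexVertex} {h : ℤ} (hl : ∀ v ∈ l, h ≤ row v) :
    IsRenewalRowList l h :=
  ⟨0, by simp, fun v hv => hl v (List.mem_of_mem_drop hv)⟩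

/-- **DEFECT (a): LOW TARGET.**  If the LAST vertex lies below row `h`, the typed renewal at `h`
holds iff the whole list lies below row `h`. [folklore] -/
theorem isRenewalRowList_iff_of_getLast_lt {l : List HexVertex} {h : ℤ} (hne : l ≠ [])
    (hlast : row (l.getLast hne) < h) : IsRenewalRowList l h ↔ ∀ v ∈ l, row v < h := by
  refine ⟨?_, isRenewalRowList_of_forall_lt⟩
  rintro ⟨k, hk1, hk2⟩
  by_cases hk : l.length ≤ k
  · intro v hv
    exact hk1 v (by rwa [List.take_of_length_le hk])
  · push Not at hk
    exfalso
    have hmem : l.getLast hne ∈ l.drop k := by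
      rw [List.getLast_eq_getElem]
      have hlt : l.length - 1 - k < (l.drop k).length := by simp; omega
      rw [List.mem_iff_getElem]
      refine ⟨l.length - 1 - k, hlt, ?_⟩
      rw [List.getElem_drop]
      congr 1
      omega
    exact absurd (hk2 _ hmem) (not_le.2 hlast)

/-- **DEFECT (b): U-PROFILE.**  A vertex at or above row `h` followed later by a vertex below row
`h` excludes the typed renewal at `h`. [folklore] -/
theorem not_isRenewalRowList_of_high_then_low {l : List HexVertex} {h : ℤ} {i j : ℕ}
    (hij : i < j) (hj : j < l.length) (hi : h ≤ row (l[i]'(hij.trans hj))) (hlow : row (l[j]) < h) :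
    ¬ IsRenewalRowList l h := by
  rintro ⟨k, hk1, hk2⟩
  by_cases hk : k ≤ i
  · have hmem : l[j] ∈ l.drop k := by
      rw [List.mem_iff_getElem]
      refine ⟨j - k, by simp; omega, ?_⟩
      rw [List.getElem_drop]
      congr 1
      omega
    exact absurd (hk2 _ hmem) (not_le.2 hlow)
  · push Not at hk
    have hmem : l[i]'(hij.trans hj) ∈ l.take k := by
      rw [List.mem_iff_getElem]
      refine ⟨i, by simp; omega, ?_⟩
      rw [List.getElem_take]
    exact absurd (hk1 _ hmem) (not_lt.2 hi)

/-- Copy of the sketch's `noRenewalObs`: spin-`σ` mass of the walks `a → z` of `Λ` with NO typed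
renewal row in the window `(h₁, h₂]`. [folklore] -/
def noRenewalObs (Λ : Finset HexVertex) (a z : Sym2 HexVertex) (x σ : ℝ) (h₁ h₂ : ℤ) : ℂ :=
  ∑ γ : HexMidEdgeSAW Λ a z,
    if ∀ h : ℤ, h₁ < h → h ≤ h₂ → ¬ IsRenewalRow γ h then γ.weight x σ else 0

/-- Copy of the sketch's `Z`: the critical two-point mass `Z_Λ(a → z)`. [folklore] -/
def Z (Λ : Finset HexVertex) (a z : Sym2 HexVertex) : ℝ :=
  (hexParafermionicObservable Λ a hexCriticalFugacity 0 z).re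

/-- DEFECT (a) AT THE LEVEL OF `noRenewalObs`: for a walk whose target mid-edge lies below the
window, "no typed renewal row in `(h₁, h₂]`" is EXACTLY "some vertex at or above row `h₂`". [folklore] -/
theorem noRenewal_iff_reaches_top {Λ : Finset HexVertex} {a z : Sym2 HexVertex}
    (γ : HexMidEdgeSAW Λ a z) {h₁ h₂ : ℤ} (hz : ∀ v ∈ z, row v ≤ h₁) (hne : γ.verts ≠ [])
    (h12 : h₁ < h₂) :
    (∀ h : ℤ, h₁ < h → h ≤ h₂ → ¬ IsRenewalRow γ h) ↔ ∃ v ∈ γ.verts, h₂ ≤ row v := by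
  have hlast : row (γ.verts.getLast hne) ≤ h₁ :=
    hz _ (γ.getLast_mem _ (List.getLast?_eq_some_getLast hne))
  have key : ∀ h : ℤ, h₁ < h → (IsRenewalRow γ h ↔ ∀ v ∈ γ.verts, row v < h) := fun h hh =>
    (isRenewalRow_iff_list γ h).trans (isRenewalRowList_iff_of_getLast_lt hne (by omega))
  constructor
  · intro H
    have := H h₂ h12 le_rfl
    rw [key h₂ h12] at this
    push Not at this
    exact this
  · rintro ⟨v, hv, hv2⟩ h hh1 hh2
    rw [key h hh1]
    push Not
    exact ⟨v, hv, by omega⟩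

/-- DEFECT (b) AT THE LEVEL OF `noRenewalObs`: if EVERY walk of `Λ` from `a` to `z` passes a
vertex at or above row `h₂` and LATER a vertex at or below row `h₁` (forced U-profile), then
`noRenewalObs` over the window `(h₁, h₂]` is the full observable. [folklore] -/
theorem noRenewalObs_eq_of_forcedU {Λ : Finset HexVertex} {a z : Sym2 HexVertex} {x σ : ℝ}
    {h₁ h₂ : ℤ}
    (H : ∀ γ : HexMidEdgeSAW Λ a z, ∃ i j : ℕ, ∃ hij : i < j, ∃ hj : j < γ.verts.length,
      h₂ ≤ row (γ.verts[i]'(hij.trans hj)) ∧ row (γ.verts[j]) ≤ h₁) :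
    noRenewalObs Λ a z x σ h₁ h₂ = hexParafermionicObservable Λ a x σ z := by
  unfold noRenewalObs hexParafermionicObservable
  refine Finset.sum_congr rfl fun γ _ => ?_
  rw [if_pos]
  intro h hh1 hh2
  obtain ⟨i, j, hij, hj, hi, hlow⟩ := H γ
  rw [isRenewalRow_iff_list]
  exact not_isRenewalRowList_of_high_then_low hij hj (by omega) (by omega)

/-- `Z > 0` as soon as one walk exists (all spin-`0` weights are `x_c^ℓ > 0`). [folklore] -/
theorem Z_pos_of_nonempty {Λ : Finset HexVertex} {a z : Sym2 HexVertex}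
    (hne : Nonempty (HexMidEdgeSAW Λ a z)) : 0 < Z Λ a z := by
  unfold Z
  rw [hexParafermionicObservable_def, Complex.re_sum]
  refine Finset.sum_pos (fun γ _ => ?_) ⟨hne.some, Finset.mem_univ _⟩
  rw [HexMidEdgeSAW.weight_zero_spin, ← Complex.ofReal_pow, Complex.ofReal_re]
  exact pow_pos hexCriticalFugacity_pos_lt_one.1 _

/-- Hence on a forcing domain with at least one walk, RR's inequality fails for every `ε < 1`:
`noRenewalObs = Z > ε Z`. [folklore] -/
theorem rr_ineq_false_of_forcedU {Λ : Finset HexVertex} {a z : Sym2 HexVertex} {h₁ h₂ : ℤ}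
    (H : ∀ γ : HexMidEdgeSAW Λ a z, ∃ i j : ℕ, ∃ hij : i < j, ∃ hj : j < γ.verts.length,
      h₂ ≤ row (γ.verts[i]'(hij.trans hj)) ∧ row (γ.verts[j]) ≤ h₁)
    (hZ : 0 < Z Λ a z) {ε : ℝ} (hε : ε < 1) :
    ¬ (noRenewalObs Λ a z hexCriticalFugacity 0 h₁ h₂).re ≤ ε * Z Λ a z := by
  rw [noRenewalObs_eq_of_forcedU H]
  unfold Z at *
  intro h
  nlinarith

/-- Packaging for the negatives index: on any instance of RR's data whose domain forces the
U-profile over the window and carries a walk, the conclusion of RR is false for `ε < 1` — so a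
single such instance for each `(K, R₀)` refutes `RootRenewal`. [folklore] -/
theorem rootRenewal_conclusion_false {Λ : Finset HexVertex} {u w : HexVertex} {z : Sym2 HexVertex}
    {m : ℤ} {d K : ℕ}
    (H : ∀ γ : HexMidEdgeSAW Λ s(u, w) z, ∃ i j : ℕ, ∃ hij : i < j, ∃ hj : j < γ.verts.length,
      m + 2 ^ K * d ≤ row (γ.verts[i]'(hij.trans hj)) ∧ row (γ.verts[j]) ≤ m + d)
    (hne : Nonempty (HexMidEdgeSAW Λ s(u, w) z)) {ε : ℝ} (hε : ε < 1) :
    ¬ (noRenewalObs Λ s(u, w) z hexCriticalFugacity 0 (m + d) (m + 2 ^ K * d)).re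
        ≤ ε * Z Λ s(u, w) z :=
  rr_ineq_false_of_forcedU H (Z_pos_of_nonempty hne) hε

end RootRenewalDefects

end Summit.CriticalPhenomena.SAWScalingLimit.Theorems.ObservableToSLER.Negative
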